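import Mathlib
import HarnessLib
import Literature.Analysis.FluidPDE.RotatingStrainFlows
import Literature.Analysis.FluidPDE.AxisymHouLiVariables
import Summits.NavierStokesRegularity.NavierStokesRegularity.Theorems.TypeIQuarterGateScarEnvelopeTypeIForcedTsaiDefs

/-!
# ARM B — TYPED-CURRENCY AUDIT of `ForcedTsaiModulusLE`: the registered statement holds at EVERY
  level, `ForcedTsaiModulusLE M δ ↔ 0 ≤ δ` (ns-wall-extremal, eng-1 lineage g3, 2026-08-29)

WHAT IS PROVED.  The registered definition
`Cruxes.ScarEnvelopeTypeI.ForcedTsai.ForcedTsaiModulusLE M δ` (`…ForcedTsaiDefs`, reviewed) asks for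
a smooth divergence-free `U : ℝ³ → ℝ³` with level `‖curl U‖_{L²(B₁₀)} ≥ M` and weighted vorticity
residual `‖(1+|y|)^{5/2} curl(−ΔU + ½U + ½y·∇U + U·∇U)‖_{L²(ℝ³)} ≤ δ` — and NO decay or
integrability condition on `U` itself.  For a LINEAR field `U(y) = My` (`M` a real `3 × 3` matrix;
tree: `Literature.Analysis.FluidPDE.RotatingStrain.lin`, Majda–Bertozzi §1.4) Leray's momentum
residual is the linear field `(M + M²)y` (`lerayMomentumResidual_lin`: `ΔU = 0`, `½U + ½y·∇U = My`,
`U·∇U = M²y`), so the vorticity residual is the constant vector of the antisymmetric part of `M + M²`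
and VANISHES whenever `M + M²` is symmetric (`lerayVorticityResidual_lin_eq_zero`); then
`(U, P)` with `P(y) = −½⟪(M + M²)y, y⟫` is an EXACT Leray profile (`isLerayProfile_lin`,
`IsLerayProfile 1 (1/2)`, for trace-free `M`).  The one-parameter strain–rotation family
  `M_c = [[−½, −c, 0], [c, −½, 0], [0, 0, 1]]`   (`M_c + M_c² = diag(−¼−c², −¼−c², 2)`;
Majda–Bertozzi Example 1.4 «rotating jet» read in Leray's backward variables, `u(x,t) = M_c x/(T−t)`)
is trace free with constant vorticity `(0, 0, 2c)`, hence: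
* `isLerayProfile_strainRotation` : an exact, unbounded, non-trivial Leray profile for every `c`
  (outside Nečas–Růžička–Šverák / Tsai, which assume `L³` / local energy, and outside every
  engine's ansatz class);
* `lerayLevel_strainRotation` : level `2|c|·|B₁₀|^{1/2}` (arbitrary), `lerayResidualNorm_strainRotation` :
  residual `0`;
* ★ `forcedTsaiModulusLE_iff_nonneg` : `ForcedTsaiModulusLE M δ ↔ 0 ≤ δ` for every `M`.

WHAT IT MEANS FOR THE CELL (RESULTS-WALL-1 §B2(d)).  Every kernel-certified row
`ForcedTsaiModulusLE M δ` of record (lanes E-exact / X / ALG) is TRUE but, as a typed statement,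
carries exactly the information `0 ≤ δ`: the typed forced-Tsai modulus `inf{residual : level ≥ M}`
is `0` at every level, attained by `y ↦ M_c y`.  The numerical content of those rows (δ/M ≈ 15–19 at
levels 4–16) is relative to the DECAY CLASS of the ansatz (Gaussian / Type-I tails), which the
registered `Prop` does not record.  REPAIR (for the exp-lead / cert hands to rule on): add the PREREG
portrait tail `∀ y, ‖U y‖ ≤ C₀/(1+‖y‖)` (PV 2026 (1.9), Type-I) — or `U ∈ L³(ℝ³)` — as a conjunct;
all landed witness rows satisfy it, and the linear family does not.

PRIOR ART IN THE TREE.  `Literature.Barriers.NavierStokesRegularity.LeraySelfSimilarBlowupExclusion`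
(`exists_isLerayProfile_ne_zero`, Tsai 1998 Remark 5.4) records the POTENTIAL profiles `U = ∇Φ`,
`Φ` harmonic — they have `curl U = 0`, i.e. level `0`, so they do not degenerate the modulus; the
VORTICAL linear family here (rotation about the stretching axis of the strain, `S e₂ = e₂`) does.
Both are instances of «Leray's system is not rigid without a decay hypothesis».

HONEST FRAME.  Elementary calculus about explicit linear fields and the registered definition;
no claim about the wall H3, crux `ScarEnvelopeTypeI` (stmt-23843, OPEN) or Navier–Stokes regularity
(NOT proved).  Theorem-only file (no definitions, no notation).
-/

noncomputable section

set_option linter.dupNamespace false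

namespace Summit.NavierStokesRegularity.NavierStokesRegularity.Cruxes.ScarEnvelopeTypeI.ForcedTsai

open MeasureTheory Set Metric Real
open scoped ContDiff Laplacian InnerProductSpace RealInnerProductSpace
open Literature.Analysis.FluidPDE Literature.Analysis.FluidPDE.RotatingStrain

/-! ## Linear fields `y ↦ My` in Leray's backward self-similar variables -/

/-- `∂ⱼ (My)ᵢ = Mᵢⱼ`. -/
theorem fderiv_lin_single (M : Matrix (Fin 3) (Fin 3) ℝ) (y : E3) (j i : Fin 3) :
    fderiv ℝ (fun y : E3 => lin M y) y (EuclideanSpace.single j 1) i = M i j := by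
  rw [show (fun y : E3 => lin M y) = ⇑(lin M) from rfl, (lin M).fderiv, lin_single]

/-- A linear field is smooth. -/
theorem contDiff_lin (M : Matrix (Fin 3) (Fin 3) ℝ) {n : WithTop ℕ∞} : ContDiff ℝ n (fun y : E3 => lin M y) :=
  (lin M).contDiff

/-- `div (My) = tr M`. -/
theorem divergence_lin (M : Matrix (Fin 3) (Fin 3) ℝ) (y : E3) :
    VectorCalculus.divergence (fun y : E3 => lin M y) y = M.trace := by
  rw [divergence_eq_sum_three, fderiv_lin_single, fderiv_lin_single, fderiv_lin_single,
    Matrix.trace_fin_three]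

/-- A trace-free linear field is divergence free. -/
theorem isDivFree_lin {M : Matrix (Fin 3) (Fin 3) ℝ} (htr : M.trace = 0) :
    VectorCalculus.IsDivFree (fun y : E3 => lin M y) := fun y => by
  rw [divergence_lin, htr]

/-- **Constant vorticity**: `curl (My) = (M₂₁ − M₁₂, M₀₂ − M₂₀, M₁₀ − M₀₁)`. -/
theorem curl_lin (M : Matrix (Fin 3) (Fin 3) ℝ) (y : E3) :
    curl (fun y : E3 => lin M y) y = WithLp.toLp 2 ![M 2 1 - M 1 2, M 0 2 - M 2 0, M 1 0 - M 0 1] := by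
  ext i
  fin_cases i <;> simp [curl, lin_single]

/-- **A linear field is harmonic**: `Δ(My) = 0` (its derivative is constant). -/
theorem laplacian_lin (M : Matrix (Fin 3) (Fin 3) ℝ) (y : E3) : (Δ (fun y : E3 => lin M y)) y = 0 := by
  have h1 : fderiv ℝ (fun y : E3 => lin M y) = fun _ => lin M := by
    funext x
    rw [show (fun y : E3 => lin M y) = ⇑(lin M) from rfl, (lin M).fderiv]
  rw [InnerProductSpace.laplacian_eq_iteratedFDeriv_orthonormalBasis _ (EuclideanSpace.basisFun (Fin 3) ℝ)]
  refine Finset.sum_eq_zero fun j _ => ?_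
  rw [iteratedFDeriv_two_apply, h1, fderiv_fun_const]
  rfl

/-- The nonlinear term: `((My)·∇)(My) = M(My) = M²y`. -/
theorem convect_lin (M : Matrix (Fin 3) (Fin 3) ℝ) (y : E3) :
    convect (fun y : E3 => lin M y) (fun y : E3 => lin M y) y = lin (M * M) y := by
  rw [convect_apply, show (fun y : E3 => lin M y) = ⇑(lin M) from rfl, (lin M).fderiv, lin_mul]

/-- **Leray's momentum residual of a linear field is linear**:
`−Δ(My) + ½My + ½D(My)[y] + ((My)·∇)(My) = (M + M²) y`. -/
theorem lerayMomentumResidual_lin (M : Matrix (Fin 3) (Fin 3) ℝ) (y : E3) :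
    lerayMomentumResidual (fun y : E3 => lin M y) y = lin (M + M * M) y := by
  rw [lerayMomentumResidual, laplacian_lin, convect_lin, lin_add,
    show (fun y : E3 => lin M y) = ⇑(lin M) from rfl, (lin M).fderiv, neg_zero, zero_add, ← add_smul,
    show (1 / 2 : ℝ) + 1 / 2 = 1 by norm_num, one_smul]
  rfl

/-- **Leray's vorticity residual of a linear field is the constant antisymmetric part of `M + M²`.** -/
theorem lerayVorticityResidual_lin (M : Matrix (Fin 3) (Fin 3) ℝ) (y : E3) :
    lerayVorticityResidual (fun y : E3 => lin M y) y =
      WithLp.toLp 2 ![(M + M * M) 2 1 - (M + M * M) 1 2, (M + M * M) 0 2 - (M + M * M) 2 0,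
        (M + M * M) 1 0 - (M + M * M) 0 1] := by
  rw [lerayVorticityResidual, show lerayMomentumResidual (fun y : E3 => lin M y) = fun y => lin (M + M * M) y
    from funext (lerayMomentumResidual_lin M), curl_lin]

/-- If `M + M²` is symmetric, the vorticity residual of `y ↦ My` VANISHES identically. -/
theorem lerayVorticityResidual_lin_eq_zero {M : Matrix (Fin 3) (Fin 3) ℝ} (hsymm : (M + M * M).IsSymm) (y : E3) :
    lerayVorticityResidual (fun y : E3 => lin M y) y = 0 := by
  have e10 : (M + M * M) 1 0 = (M + M * M) 0 1 := hsymm.apply 0 1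
  have e20 : (M + M * M) 2 0 = (M + M * M) 0 2 := hsymm.apply 0 2
  have e21 : (M + M * M) 2 1 = (M + M * M) 1 2 := hsymm.apply 1 2
  rw [lerayVorticityResidual_lin, e10, e20, e21, sub_self, sub_self, sub_self]
  ext i
  fin_cases i <;> simp

/-- Coordinates of a gradient on `ℝ³`: `(∇P)(y) i = DP(y) eᵢ`. [folklore] -/
private theorem gradient_coord (P : E3 → ℝ) (y : E3) (i : Fin 3) :
    gradient P y i = fderiv ℝ P y (EuclideanSpace.single i 1) := by
  have h : ⟪EuclideanSpace.single i (1 : ℝ), gradient P y⟫ = gradient P y i := by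
    rw [EuclideanSpace.inner_single_left]; simp
  rw [← h, real_inner_comm, gradient, InnerProductSpace.toDual_symm_apply]

/-- The quadratic form `−½⟪By, y⟫` as a polynomial in the coordinates. -/
theorem quadForm_eq_sum (B : Matrix (Fin 3) (Fin 3) ℝ) (y : E3) :
    -(1 / 2 : ℝ) * ⟪lin B y, y⟫ = -(1 / 2 : ℝ) * ∑ i : Fin 3, (∑ j : Fin 3, B i j * y j) * y i := by
  simp only [PiLp.inner_apply, lin_apply, RCLike.inner_apply, conj_trivial]
  congr 1
  exact Finset.sum_congr rfl fun i _ => by ring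

/-- The derivative of the quadratic form `−½⟪By, y⟫` (verbatim the computation of
`RotatingStrain.hasFDerivAt_pressure`). -/
theorem hasFDerivAt_quadForm (B : Matrix (Fin 3) (Fin 3) ℝ) (y : E3) :
    HasFDerivAt (fun y : E3 => -(1 / 2 : ℝ) * ⟪lin B y, y⟫)
      ((-(1 / 2 : ℝ)) • ∑ i : Fin 3,
        ((∑ j : Fin 3, B i j * y j) • (EuclideanSpace.proj i : E3 →L[ℝ] ℝ) +
          y i • ∑ j : Fin 3, (B i j) • (EuclideanSpace.proj j : E3 →L[ℝ] ℝ))) y := by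
  rw [show (fun y : E3 => -(1 / 2 : ℝ) * ⟪lin B y, y⟫) = fun y => -(1 / 2 : ℝ) * ∑ i : Fin 3,
      (∑ j : Fin 3, B i j * y j) * y i from funext (quadForm_eq_sum B)]
  have hc : ∀ j : Fin 3, HasFDerivAt (fun z : E3 => z j) (EuclideanSpace.proj j : E3 →L[ℝ] ℝ) y :=
    fun j => (EuclideanSpace.proj j : E3 →L[ℝ] ℝ).hasFDerivAt
  have h : ∀ i : Fin 3, HasFDerivAt (fun z : E3 => (∑ j : Fin 3, B i j * z j) * z i)
      ((∑ j : Fin 3, B i j * y j) • (EuclideanSpace.proj i : E3 →L[ℝ] ℝ) +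
        y i • ∑ j : Fin 3, (B i j) • (EuclideanSpace.proj j : E3 →L[ℝ] ℝ)) y := by
    intro i
    have hs : HasFDerivAt (fun z : E3 => ∑ j : Fin 3, B i j * z j)
        (∑ j : Fin 3, (B i j) • (EuclideanSpace.proj j : E3 →L[ℝ] ℝ)) y :=
      HasFDerivAt.fun_sum fun j _ => (hc j).const_mul (B i j)
    exact hs.mul (hc i)
  exact (HasFDerivAt.fun_sum fun i _ => h i).const_mul (-(1 / 2 : ℝ))

/-- The quadratic form is smooth. -/
theorem contDiff_quadForm (B : Matrix (Fin 3) (Fin 3) ℝ) {n : WithTop ℕ∞} :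
    ContDiff ℝ n (fun y : E3 => -(1 / 2 : ℝ) * ⟪lin B y, y⟫) := by
  rw [show (fun y : E3 => -(1 / 2 : ℝ) * ⟪lin B y, y⟫) = fun y => -(1 / 2 : ℝ) * ∑ i : Fin 3,
      (∑ j : Fin 3, B i j * y j) * y i from funext (quadForm_eq_sum B)]
  have hc : ∀ j : Fin 3, ContDiff ℝ n (fun y : E3 => y j) := fun j =>
    (EuclideanSpace.proj j : E3 →L[ℝ] ℝ).contDiff
  exact contDiff_const.mul (ContDiff.sum fun i _ =>
    (ContDiff.sum fun j _ => contDiff_const.mul (hc j)).mul (hc i))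

/-- **`∇(−½⟪By, y⟫) = −By` for symmetric `B`.** -/
theorem gradient_quadForm {B : Matrix (Fin 3) (Fin 3) ℝ} (hsymm : B.IsSymm) (y : E3) :
    gradient (fun y : E3 => -(1 / 2 : ℝ) * ⟪lin B y, y⟫) y = -(lin B y) := by
  have e10 : B 1 0 = B 0 1 := hsymm.apply 0 1
  have e20 : B 2 0 = B 0 2 := hsymm.apply 0 2
  have e21 : B 2 1 = B 1 2 := hsymm.apply 1 2
  ext m
  rw [gradient_coord, (hasFDerivAt_quadForm B y).fderiv]
  fin_cases m <;> simp [Fin.sum_univ_three, lin_apply, e10, e20, e21] <;> ring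

/-- ★ **Exact linear Leray profiles.** If `M` is trace free and `M + M²` is symmetric, then
`U(y) = My`, `P(y) = −½⟪(M + M²)y, y⟫` solve Leray's backward profile system
`−ΔU + ½U + ½y·∇U + U·∇U + ∇P = 0`, `div U = 0` (`IsLerayProfile 1 (1/2)`; unbounded, so outside the
hypotheses of Nečas–Růžička–Šverák 1996 / Tsai 1998). -/
theorem isLerayProfile_lin {M : Matrix (Fin 3) (Fin 3) ℝ} (htr : M.trace = 0) (hsymm : (M + M * M).IsSymm) :
    IsLerayProfile 1 (1 / 2) (fun y : E3 => lin M y) (fun y : E3 => -(1 / 2 : ℝ) * ⟪lin (M + M * M) y, y⟫) where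
  contDiff_velocity := contDiff_lin M
  contDiff_pressure := contDiff_quadForm (M + M * M)
  profile_eq y := by
    have h := lerayMomentumResidual_lin M y
    rw [lerayMomentumResidual] at h
    rw [one_smul, h, gradient_quadForm hsymm, add_neg_cancel]
  divFree := isDivFree_lin htr

/-- The local enstrophy of a linear field: `∫_{B₁₀} ‖curl(My)‖² = |B₁₀|·‖curl‖²`. -/
theorem integral_curl_sq_lin (M : Matrix (Fin 3) (Fin 3) ℝ) :
    ∫ y in ball (0 : E3) 10, ‖curl (fun y : E3 => lin M y) y‖ ^ 2 =
      volume.real (ball (0 : E3) 10) *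
        ‖(WithLp.toLp 2 ![M 2 1 - M 1 2, M 0 2 - M 2 0, M 1 0 - M 0 1] : E3)‖ ^ 2 := by
  simp only [curl_lin, setIntegral_const, smul_eq_mul]

/-- `|B₁₀| > 0` in `ℝ³`. -/
theorem volume_ball_ten_pos : 0 < volume.real (ball (0 : E3) 10) := by
  rw [measureReal_def]
  exact ENNReal.toReal_pos (measure_ball_pos volume (0 : E3) (by norm_num)).ne' measure_ball_lt_top.ne

/-! ## The strain–rotation family `M_c = [[−½, −c, 0], [c, −½, 0], [0, 0, 1]]` -/

/-- `tr M_c = 0`. -/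
theorem trace_strainRotation (c : ℝ) :
    (!![-(1 / 2 : ℝ), -c, 0; c, -(1 / 2 : ℝ), 0; 0, 0, 1] : Matrix (Fin 3) (Fin 3) ℝ).trace = 0 := by
  rw [Matrix.trace_fin_three]
  simp
  norm_num

/-- `M_c + M_c² = diag(−¼ − c², −¼ − c², 2)`. -/
theorem resMat_strainRotation (c : ℝ) :
    (!![-(1 / 2 : ℝ), -c, 0; c, -(1 / 2 : ℝ), 0; 0, 0, 1] : Matrix (Fin 3) (Fin 3) ℝ) +
        !![-(1 / 2 : ℝ), -c, 0; c, -(1 / 2 : ℝ), 0; 0, 0, 1] * !![-(1 / 2 : ℝ), -c, 0; c, -(1 / 2 : ℝ), 0; 0, 0, 1] =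
      !![-(1 / 4 : ℝ) - c ^ 2, 0, 0; 0, -(1 / 4 : ℝ) - c ^ 2, 0; 0, 0, 2] := by
  ext i j
  fin_cases i <;> fin_cases j <;> simp <;> ring

/-- `M_c + M_c²` is symmetric (it is diagonal). -/
theorem resMat_strainRotation_isSymm (c : ℝ) :
    ((!![-(1 / 2 : ℝ), -c, 0; c, -(1 / 2 : ℝ), 0; 0, 0, 1] : Matrix (Fin 3) (Fin 3) ℝ) +
        !![-(1 / 2 : ℝ), -c, 0; c, -(1 / 2 : ℝ), 0; 0, 0, 1] * !![-(1 / 2 : ℝ), -c, 0; c, -(1 / 2 : ℝ), 0; 0, 0, 1]).IsSymm := by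
  rw [resMat_strainRotation]
  refine Matrix.IsSymm.ext fun i j => ?_
  fin_cases i <;> fin_cases j <;> simp

/-- ★ **The strain–rotation profiles are exact Leray profiles**: for every `c`,
`U_c(y) = (−½y₀ − c y₁, c y₀ − ½y₁, y₂)` with `P_c(y) = (¼ + c²)(y₀² + y₁²)/2 − y₂²` satisfies
`IsLerayProfile 1 (1/2) U_c P_c` — unbounded and, for `c ≠ 0`, with non-zero vorticity. -/
theorem isLerayProfile_strainRotation (c : ℝ) :
    IsLerayProfile 1 (1 / 2) (fun y : E3 => lin !![-(1 / 2 : ℝ), -c, 0; c, -(1 / 2 : ℝ), 0; 0, 0, 1] y)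
      (fun y : E3 => -(1 / 2 : ℝ) *
        ⟪lin (!![-(1 / 2 : ℝ), -c, 0; c, -(1 / 2 : ℝ), 0; 0, 0, 1] +
          !![-(1 / 2 : ℝ), -c, 0; c, -(1 / 2 : ℝ), 0; 0, 0, 1] * !![-(1 / 2 : ℝ), -c, 0; c, -(1 / 2 : ℝ), 0; 0, 0, 1]) y, y⟫) :=
  isLerayProfile_lin (trace_strainRotation c) (resMat_strainRotation_isSymm c)

/-- **Constant vorticity** `curl U_c = (0, 0, 2c)`. -/
theorem curl_strainRotation (c : ℝ) (y : E3) :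
    curl (fun y : E3 => lin !![-(1 / 2 : ℝ), -c, 0; c, -(1 / 2 : ℝ), 0; 0, 0, 1] y) y =
      (2 * c) • EuclideanSpace.single 2 (1 : ℝ) := by
  rw [curl_lin]
  ext i
  fin_cases i
  · simp
  · simp
  · simp; ring

/-- **The vorticity residual of `U_c` vanishes identically.** -/
theorem lerayVorticityResidual_strainRotation (c : ℝ) (y : E3) :
    lerayVorticityResidual (fun y : E3 => lin !![-(1 / 2 : ℝ), -c, 0; c, -(1 / 2 : ℝ), 0; 0, 0, 1] y) y = 0 :=
  lerayVorticityResidual_lin_eq_zero (resMat_strainRotation_isSymm c) y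

/-- **The level of `U_c`** in the registered currency: `‖curl U_c‖_{L²(B₁₀)} = 2|c|·|B₁₀|^{1/2}`. -/
theorem lerayLevel_strainRotation (c : ℝ) :
    lerayLevel (fun y : E3 => lin !![-(1 / 2 : ℝ), -c, 0; c, -(1 / 2 : ℝ), 0; 0, 0, 1] y) =
      2 * |c| * Real.sqrt (volume.real (ball (0 : E3) 10)) := by
  rw [lerayLevel, show (fun y : E3 => ‖curl (fun y : E3 => lin !![-(1 / 2 : ℝ), -c, 0; c, -(1 / 2 : ℝ), 0; 0, 0, 1] y) y‖ ^ 2)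
      = fun _ => (2 * c) ^ 2 from funext fun y => by
        rw [curl_strainRotation, norm_smul, PiLp.norm_single, norm_one, mul_one, Real.norm_eq_abs, sq_abs],
    setIntegral_const, smul_eq_mul, Real.sqrt_mul volume_ball_ten_pos.le, Real.sqrt_sq_eq_abs, abs_mul, abs_two]
  ring

/-- The weighted residual integrand of `U_c` is the zero function. -/
theorem residualIntegrand_strainRotation (c : ℝ) :
    (fun y : E3 => (1 + ‖y‖) ^ 5 *
        ‖lerayVorticityResidual (fun y : E3 => lin !![-(1 / 2 : ℝ), -c, 0; c, -(1 / 2 : ℝ), 0; 0, 0, 1] y) y‖ ^ 2) =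
      fun _ => 0 := by
  funext y
  rw [lerayVorticityResidual_strainRotation, norm_zero]
  ring

/-- The weighted residual of `U_c` is integrable (it is `0`). -/
theorem integrable_residual_strainRotation (c : ℝ) :
    Integrable (fun y : E3 => (1 + ‖y‖) ^ 5 *
      ‖lerayVorticityResidual (fun y : E3 => lin !![-(1 / 2 : ℝ), -c, 0; c, -(1 / 2 : ℝ), 0; 0, 0, 1] y) y‖ ^ 2) := by
  rw [residualIntegrand_strainRotation]
  exact integrable_zero _ _ _

/-- **The residual norm of `U_c` is `0`.** -/
theorem lerayResidualNorm_strainRotation (c : ℝ) :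
    lerayResidualNorm (fun y : E3 => lin !![-(1 / 2 : ℝ), -c, 0; c, -(1 / 2 : ℝ), 0; 0, 0, 1] y) = 0 := by
  rw [lerayResidualNorm, residualIntegrand_strainRotation, integral_zero, Real.sqrt_zero]

/-! ## The registered statement holds at every level -/

/-- ★ **Every row of the registered statement holds**: for every level `M` and every `δ ≥ 0`,
`ForcedTsaiModulusLE M δ` — witnessed by the strain–rotation profile `U_c` with
`c = (|M| + 1)/(2|B₁₀|^{1/2})` (level `|M| + 1 ≥ M`, residual `0`).  The typed forced-Tsai modulus is
`0` at every level; certified rows carry information only relative to an (untyped) decay class. -/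
theorem forcedTsaiModulusLE_of_nonneg (M : ℝ) {δ : ℝ} (hδ : 0 ≤ δ) : ForcedTsaiModulusLE M δ := by
  set c : ℝ := (|M| + 1) / (2 * Real.sqrt (volume.real (ball (0 : E3) 10))) with hc_def
  have hs : 0 < Real.sqrt (volume.real (ball (0 : E3) 10)) := Real.sqrt_pos.2 volume_ball_ten_pos
  have hc : 0 ≤ c := by positivity
  refine ⟨fun y : E3 => lin !![-(1 / 2 : ℝ), -c, 0; c, -(1 / 2 : ℝ), 0; 0, 0, 1] y, contDiff_lin _,
    isDivFree_lin (trace_strainRotation c), ?_, integrable_residual_strainRotation c, ?_⟩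
  · rw [lerayLevel_strainRotation, abs_of_nonneg hc, hc_def]
    field_simp
    linarith [le_abs_self M]
  · rw [lerayResidualNorm_strainRotation]; exact hδ

/-- In particular `ForcedTsaiModulusLE M 0` for every `M`: the typed modulus vanishes identically. -/
theorem forcedTsaiModulusLE_zero (M : ℝ) : ForcedTsaiModulusLE M 0 := forcedTsaiModulusLE_of_nonneg M le_rfl

/-- ★ **The registered statement is equivalent to `0 ≤ δ`** (the residual norm is a square root,
hence non-negative; conversely the strain–rotation profile witnesses every non-negative `δ`). -/
theorem forcedTsaiModulusLE_iff_nonneg (M δ : ℝ) : ForcedTsaiModulusLE M δ ↔ 0 ≤ δ :=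
  ⟨fun ⟨_, _, _, _, _, hres⟩ => (Real.sqrt_nonneg _).trans hres, fun h => forcedTsaiModulusLE_of_nonneg M h⟩

end Summit.NavierStokesRegularity.NavierStokesRegularity.Cruxes.ScarEnvelopeTypeI.ForcedTsai

end
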